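/-
Origin: expansion seat `prover-pub-hodgecm-own-htheta-0`, handover #H10 2026-08-21T05:28Z md5 a4b4f9c70cd1 (323 l.; NEW additive KERNEL leaf beside E; imports #H9 `HodgeCM.Model.HThetaBlockSlots23` + #H7 `HodgeCM.Model.HsmallOfBlockAt` + #H2 `HodgeCM.Model.LiuIndexMuLiuR2` (RUN 72) + binder-1 #R131 `HodgeCM.Model.AdelicThetaDistributionMultPinR2` + sinst-1 #1272 `HodgeCM.Model.AdelicThetaSlotPinsR2` (RUN 71); ns HodgeCM.Model.SInstance; 6 theorems 0 defs: THE (J-Liu-Θ) JUNCTION THEOREM AT THE R2 PIN FROM `Thm418C` ALONE — `hJ_ROGT'C_block_{zero,one,two,three}` (#H8 ∕ #H9 at S := SROGT'C, every hypothesis BY NAME exactly as #H3: binder-1 #R131 socket table, sinst-1 #1272, carch #CA72 ∕ #CA73 `hw`, #H2 `hμ`), `hJ_ROGT'C_block` (∀ i : Fin 4), **`hsmall_ROGT'C_of_thm418C`**: E's `hsmall` at (V, c, i) for ANY theta model inside the pin's theta classes from `h418 : ∀ a₀, (liuDictionaryPin … V (I V (repAt a₀) (muLiu ι₁ rep)) (line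 …)).Thm418C` + `hR` + the pin's inputs `hGR×5 ∕ μ ∕ hΔ₁₂₃` + `GOG` + E's scope `h6` — NO `Irreducible ∕ Prop413 ∕ Thm418_2 ∕ MuSeparated`; ROWDEPS #H9, #H7, PKG #H2 (DEFER if RUN 72 drops #H2); NAMES for audit: HodgeCM.Model.SInstance.hJ_ROGT'C_block_zero · HodgeCM.Model.SInstance.hJ_ROGT'C_block · HodgeCM.Model.SInstance.hsmall_ROGT'C_of_thm418C) (`HOME/pub-hodgecm-own-htheta/stage73/HodgeCM/Model/HThetaJunctionR2B.lean`, md5 a4b4f9c70cd1, 323 lines);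
landed by the gen-31 packager (p-g31) in gate run 73 as `HodgeCM/Model/HThetaJunctionR2B.lean` (verbatim).
-/
/-
Copyright (c) 2026 the pub-hodgecm formalisation cell (harness21).  New file, not vendored.
Origin: ROW-9 OWNER seat `prover-pub-hodgecm-own-htheta-0` (unit pub-hodgecm-own-htheta, the SINGLE OWNER of the (J-Liu-Θ) junction theorem,
coordinator ruling «GO 1–5» (2)), 2026-08-21.  Target in PKG: `HodgeCM/Model/HThetaJunctionR2B.lean` (NEW additive KERNEL leaf beside E;
imports this seat's `Model/HThetaBlockSlots23` (→ `HThetaBlockSlots01` → binder-2 `Binders/JLiuSlots01 ∕ 23`, RUN 72), `Model/HsmallOfBlockAt`,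
#H2 `Model/LiuIndexMuLiuR2` (RUN 72), binder-1 #R131 `Model/AdelicThetaDistributionMultPinR2`, sinst-1 #1272 `Model/AdelicThetaSlotPinsR2`
(RUN 71); nothing imports it; outside E's import closure).  KERNEL ONLY: theorems; 0 defs, 0 records, nothing cited, 0 `def … : Prop`.
Nothing here is a claim of the manuscripts under adjudication.
-/
import Summits.HodgeConjecture.HodgeCM.Model.HThetaBlockSlots23
import Summits.HodgeConjecture.HodgeCM.Model.HsmallOfBlockAt
import Summits.HodgeConjecture.HodgeCM.Model.LiuIndexMuLiuR2
import Summits.HodgeConjecture.HodgeCM.Model.AdelicThetaDistributionMultPinR2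
import Summits.HodgeConjecture.HodgeCM.Model.AdelicThetaSlotPinsR2

set_option autoImplicit false

/-!
# THE (J-Liu-Θ) JUNCTION THEOREM AT THE PIN OF RECORD R2 FROM `Thm418C` ALONE — one index, one block

`Model/HThetaJunctionR2` (#H3) derives E's `hsmall` at the pin `SROGT'C` from the FIVE dictionary sentences `hcite = Irreducible ∧ Prop413 ∧
Thm418_2 ∧ MuSeparated ∧ Thm418C` because the landed sockets place the tower vector of a theta class in a SUM of blocks.  At the pin the sum
has ONE term (binder-2's slot theorems take `T := {j_k}`); this file runs the same composition through the single-block sockets: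

* § 1 `hJ_ROGT'C_block_{zero,one,two,three}` — this seat's `hJ_slot_k_block_of_lineRepOf` (`Model/HThetaBlockSlots01 ∕ 23`: binder-2's
  pin-generic slot theorems with the conclusion `∃ j, … ∧ ofLevel cf ∈ block j`) at `S := SROGT'C`, every hypothesis supplied BY NAME exactly
  as in #H3 (binder-1 #R131 socket table, sinst-1 #1272, carch #CA72 ∕ #CA73 `hw`, this seat's #H2 `hμ`);
* § 2 `hJ_ROGT'C_block` — all four slots, index pointed at `⟨c.D.a i, …⟩`;
* § 3 **`hsmall_ROGT'C_of_thm418C`** — E's `hsmall` at `(V, c, i)` for ANY theta model inside the pin's theta classes, from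
  **`h418 : ∀ a₀, (liuDictionaryPin … V (I V (repAt a₀) (muLiu ι₁ rep)) (line …)).Thm418C` ALONE** (+ Riemann `hR`, the pin's inputs
  `hGR×5 ∕ μ ∕ hΔ₁₂₃`, the guard `GOG`, E's scope `h6`), via this seat's `hsmall_of_pin_at_block_of_isometric` (`Model/HsmallOfBlockAt` at the
  pinned dictionary).  `Irreducible`, `Prop413`, `Thm418_2` and the displayed model hypothesis `MuSeparated` are NOT hypotheses of this
  theorem: the citation surface of the junction is the combined reading r8 of [Liu21, Thm. 4.18 + (4.3) + Thm. 4.18 (1) + Rem. 4.17 +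
  Prop. 4.13 (mult. one) + Lem. 2.4 (1)] and nothing else.
All `[folklore]`.
-/

noncomputable section

open NumberField NumberField.InfinitePlace NumberField.mixedEmbedding IsDedekindDomain
open scoped Matrix Classical TensorProduct SchwartzMap
open MulAction
open Literature.Geometry.ComplexHyperbolic.BallModel (U21 x₀ stabilizerEquivK21)
open Literature.NumberTheory.Automorphic.U21 (K21 matA sclD)
open Literature.AlgebraicGeometry.ShimuraVarieties Literature.AlgebraicGeometry.ShimuraVarieties.BallForms
open Literature.AlgebraicGeometry.HodgeTheory Literature.NumberTheory.Automorphic.PicardCM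
open Literature.NumberTheory.Transcendental (Arapura2012_Cor_15_4_6)
open Literature.NumberTheory.Automorphic Literature.NumberTheory.Automorphic.UnitaryGroup Literature.NumberTheory.Weil1964
open Literature.NumberTheory.GelbartRogawski1991 Literature.NumberTheory.GelbartRogawski1991.UnitaryDualPair
open HodgeCM.Adelic HodgeCM.PerL34 HodgeCM.Model.HypCensus HodgeCM.Model.SupplyInstance HodgeCM.Model.ArchSideTerm
open HodgeCM.Model.ThetaSpace HodgeCM.Model.TowerLevel HodgeCM.Model.TowerCarrier HodgeCM.Literature.Theta

namespace HodgeCM.Model.SInstance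

open HodgeCM.Model.ThetaAdelicSide HodgeCM.Model.LiuIndex

variable (hHD : exists_isReal_hodgeModel) (hI : hodgePQ_independent_of_hodgeModel)
  (h₁ : BallQuotientUniformised) (h₃ : CMAbelianVarietyRealised) (hA : Arapura2012_Cor_15_4_6)

variable
  (hGR : ∀ {L : CMField} {ι₁ : L →+* ℂ} (V : HermSpace3 L ι₁) (c : SeesawCtx L),
    (cmSplittingDatum (L : Type) finProdFinEquiv (frameD V) (frameD_real V) (frameD_ne V) (dW c.D) (dW_real c.D)
      (dW_ne c.D)).CompatibleSplitting)
  (hGR₀ : ∀ {L : CMField} {ι₁ : L →+* ℂ} (V : HermSpace3 L ι₁) (c : SeesawCtx L),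
    (cmSplittingDatum (L : Type) (e₁) (frameD V) (frameD_real V) (frameD_ne V) (lineVec (L : Type) (dW c.D 0))
      (fun _ => dW_real c.D 0) (fun _ => dW_ne c.D 0)).CompatibleSplitting)
  (hGR₁ : ∀ {L : CMField} {ι₁ : L →+* ℂ} (V : HermSpace3 L ι₁) (c : SeesawCtx L),
    (cmSplittingDatum (L : Type) (e₁) (frameD V) (frameD_real V) (frameD_ne V) (lineVec (L : Type) (dW c.D 1))
      (fun _ => dW_real c.D 1) (fun _ => dW_ne c.D 1)).CompatibleSplitting)
  (hGR₂ : ∀ {L : CMField} {ι₁ : L →+* ℂ} (V : HermSpace3 L ι₁) (c : SeesawCtx L),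
    (cmSplittingDatum (L : Type) (e₁) (frameD V) (frameD_real V) (frameD_ne V) (lineVec (L : Type) (dW' c.D 0))
      (fun _ => dW'_real c.D 0) (fun _ => dW'_ne c.D 0)).CompatibleSplitting)
  (hGR₃ : ∀ {L : CMField} {ι₁ : L →+* ℂ} (V : HermSpace3 L ι₁) (c : SeesawCtx L),
    (cmSplittingDatum (L : Type) (e₁) (frameD V) (frameD_real V) (frameD_ne V) (lineVec (L : Type) (dW' c.D 1))
      (fun _ => dW'_real c.D 1) (fun _ => dW'_ne c.D 1)).CompatibleSplitting)
  (μ : ∀ {L : CMField}, SeesawCtx L → Fin 4 → NumberField.InfinitePlace (L : Type) → ℤ)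
  (hΔ₁ : ∀ {L : CMField} {ι₁ : L →+* ℂ} (V : HermSpace3 L ι₁) (c : SeesawCtx L), ∀ hc : GOG V c,
    slotTypeVec V c (hGR V c) (hGR₀ V c) (hGR₁ V c) (hGR₂ V c) (hGR₃ V c) (hG_GOG V c hc) 1 -
      slotTypeVec V c (hGR V c) (hGR₀ V c) (hGR₁ V c) (hGR₂ V c) (hGR₃ V c) (hG_GOG V c hc) 0 = μ c 1 - μ c 0)
  (hΔ₂ : ∀ {L : CMField} {ι₁ : L →+* ℂ} (V : HermSpace3 L ι₁) (c : SeesawCtx L), ∀ hc : GOG V c,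
    slotTypeVec V c (hGR V c) (hGR₀ V c) (hGR₁ V c) (hGR₂ V c) (hGR₃ V c) (hG_GOG V c hc) 2 -
      slotTypeVec V c (hGR V c) (hGR₀ V c) (hGR₁ V c) (hGR₂ V c) (hGR₃ V c) (hG_GOG V c hc) 0 = μ c 2 - μ c 0)
  (hΔ₃ : ∀ {L : CMField} {ι₁ : L →+* ℂ} (V : HermSpace3 L ι₁) (c : SeesawCtx L), ∀ hc : GOG V c,
    slotTypeVec V c (hGR V c) (hGR₀ V c) (hGR₁ V c) (hGR₂ V c) (hGR₃ V c) (hG_GOG V c hc) 3 -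
      slotTypeVec V c (hGR V c) (hGR₀ V c) (hGR₁ V c) (hGR₂ V c) (hGR₃ V c) (hG_GOG V c hc) 0 = μ c 3 - μ c 0)

variable {L : CMField} {ι₁ : L →+* ℂ} (V : HermSpace3 L ι₁) (c : SeesawCtx L)


/-! ## § 1  The four slots at the pin of record -/

/-- **slot 0 of the junction binder `hJ` AT THE PIN OF RECORD R2**, recipe of record `μ₀ := muLiu ι₁ rep`, EVERY hypothesis discharged
(`hJ_slot_zero_block_of_lineRepOf` ∘ binder-1 #R131 socket table ∘ sinst-1 #1272 ∘ carch #CA72∕73 `hw` ∘ this seat's #H2 `hμ`). [folklore] -/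
theorem hJ_ROGT'C_block_zero (hc : GOG V c) (hV : IsAnisotropic L V.Hm) :
    ∃ j : LiuIndex.I V (LiuIndex.repAt (aZeroJ c)) (muLiu ι₁ LiuIndex.GramClass.rep),
      (∃ z : (L : Type), z ≠ 0 ∧
        (LiuIndex.line V (LiuIndex.repAt (aZeroJ c)) (muLiu ι₁ LiuIndex.GramClass.rep) j).scalar = z * conjRingHomK L z * c.D.a 0) ∧
      ∀ (Γ : Level V) (hΓ : Γ.BelowConjThree),
        ∀ ω ∈ thetaOf _ (thetaClassInputOf _ (fun V c => thetaSpaceInputOf hHD hI h₁ h₃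
            (SROGT'C @hGR @hGR₀ @hGR₁ @hGR₂ @hGR₃ @μ hΔ₁ hΔ₂ hΔ₃) V c)) V c 0 Γ,
          ∃ cf : towerLevel hHD hI (ballQuotientUniformisedDatum_of h₁) h₃ hA Γ hΓ,
            TowerLevel.res hHD hI (ballQuotientUniformisedDatum_of h₁) h₃ hA cf = ω ∧
              (ofLevel hHD hI (ballQuotientUniformisedDatum_of h₁) h₃ hA Γ hΓ cf :
                  (liuDictionaryPin hHD hI h₁ h₃ hA V (LiuIndex.I V (LiuIndex.repAt (aZeroJ c)) (muLiu ι₁ LiuIndex.GramClass.rep))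
                    (LiuIndex.line V (LiuIndex.repAt (aZeroJ c)) (muLiu ι₁ LiuIndex.GramClass.rep))).H) ∈
                (liuDictionaryPin hHD hI h₁ h₃ hA V (LiuIndex.I V (LiuIndex.repAt (aZeroJ c)) (muLiu ι₁ LiuIndex.GramClass.rep))
                  (LiuIndex.line V (LiuIndex.repAt (aZeroJ c)) (muLiu ι₁ LiuIndex.GramClass.rep))).block j :=
  hJ_slot_zero_block_of_lineRepOf hHD hI h₁ h₃ hA V c (SROGT'C @hGR @hGR₀ @hGR₁ @hGR₂ @hGR₃ @μ hΔ₁ hΔ₂ hΔ₃ V c)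
    (hGR V c) (hGR₀ V c) (hGR₁ V c) (hGR₂ V c) (hGR₃ V c)
    (etaT₀ V c.D (EtaChi.η (@χVR @hGR @hGR₀ @hGR₁) (@χWR @hGR @hGR₀ @hGR₁ @μ) V c) (νR @hGR₁ V c))
    (etaT₁ V c.D (EtaChi.η (@χVR @hGR @hGR₀ @hGR₁) (@χWR @hGR @hGR₀ @hGR₁ @μ) V c) (νR @hGR₁ V c))
    (etaT₂ V c.D (EtaChi.η (@χVR @hGR @hGR₀ @hGR₁) (@χWR @hGR @hGR₀ @hGR₁ @μ) V c) (ν'R @hGR₃ V c))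
    (etaT₃ V c.D (EtaChi.η (@χVR @hGR @hGR₀ @hGR₁) (@χWR @hGR @hGR₀ @hGR₁ @μ) V c) (ν'R @hGR₃ V c))
    (SROGT'C_ιinf @hGR @hGR₀ @hGR₁ @hGR₂ @hGR₃ @μ hΔ₁ hΔ₂ hΔ₃ V c hc) (hG_GOG V c hc) hV hc.1
    (muLiu ι₁ LiuIndex.GramClass.rep)
    (SROGT'C_P_ω_lineRepOf @hGR @hGR₀ @hGR₁ @hGR₂ @hGR₃ @μ hΔ₁ hΔ₂ hΔ₃ V c hc 0)
    (continuous_etaT₀ V c.D _ _ (EtaChi.hηc (@χVR @hGR @hGR₀ @hGR₁) (@χWR @hGR @hGR₀ @hGR₁ @μ) V c) (hνcR @hGR₁ V c))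
    (posIdxEquivUnit (hpos_GOG V c hc).1) (negIdxEquivEmpty (hpos_GOG V c hc).1)
    (hχ_zero_ROGTC @hGR @hGR₀ @hGR₁ @μ V c hc)
    (defExponentZero V c (hGR₀ V c) (hpos_GOG V c hc).1) (defExponentZero_spec V c (hGR₀ V c) (hpos_GOG V c hc).1)
    (hdef_zero_ROGTC @hGR @hGR₀ @hGR₁ @μ V c hc)
    (SROGT'C @hGR @hGR₀ @hGR₁ @hGR₂ @hGR₃ @μ hΔ₁ hΔ₂ hΔ₃) rfl
    (satG_le_SROGT'C_Gfin @hGR @hGR₀ @hGR₁ @hGR₂ @hGR₃ @μ hΔ₁ hΔ₂ hΔ₃ V c hc hV)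
    (hLF_ROGT'C @hGR @hGR₀ @hGR₁ @hGR₂ @hGR₃ @μ hΔ₁ hΔ₂ hΔ₃ V c 0)
    (etaT₀_V_rat V c _ (EtaChi.hη (@χVR @hGR @hGR₀ @hGR₁) (@χWR @hGR @hGR₀ @hGR₁ @μ) V c) (νR @hGR₁ V c) (hνR @hGR₁ V c))
    (etaT₀_W_rat V c _ (EtaChi.hη (@χVR @hGR @hGR₀ @hGR₁) (@χWR @hGR @hGR₀ @hGR₁ @μ) V c) (νR @hGR₁ V c) (hνR @hGR₁ V c))
    (continuous_adelicCharZeroG_val V c (hGR V c) (hGR₀ V c) (hGR₁ V c) _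
      (continuous_etaT₀ V c.D _ _ (EtaChi.hηc (@χVR @hGR @hGR₀ @hGR₁) (@χWR @hGR @hGR₀ @hGR₁ @μ) V c) (hνcR @hGR₁ V c)) (hG_GOG V c hc))
    (muLiu_mk_eq_add_ROGT'C_zero @hGR @hGR₀ @hGR₁ @μ V c LiuIndex.GramClass.rep LiuIndex.GramClass.mk_rep hc
      (continuous_adelicCharZeroG_val V c (hGR V c) (hGR₀ V c) (hGR₁ V c) _
      (continuous_etaT₀ V c.D _ _ (EtaChi.hηc (@χVR @hGR @hGR₀ @hGR₁) (@χWR @hGR @hGR₀ @hGR₁ @μ) V c) (hνcR @hGR₁ V c)) (hG_GOG V c hc)))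
    (fun t => w_ROGT'C_mul_lineCharV_zero_eq_torusScalar @hGR @hGR₀ @hGR₁ @hGR₂ @hGR₃ @μ hΔ₁ hΔ₂ hΔ₃ V c hc t)

/-- **slot 1 of the junction binder `hJ` AT THE PIN OF RECORD R2**, recipe of record `μ₀ := muLiu ι₁ rep`, EVERY hypothesis discharged
(binder-2 `hJ_slot_one_of_lineRepOf` ∘ binder-1 #R131 socket table ∘ sinst-1 #1272 ∘ carch #CA72∕73 `hw` ∘ this seat's #H2 `hμ`). [folklore] -/
theorem hJ_ROGT'C_block_one (hc : GOG V c) (hV : IsAnisotropic L V.Hm) :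
    ∃ j : LiuIndex.I V (LiuIndex.repAt (aOneJ c)) (muLiu ι₁ LiuIndex.GramClass.rep),
      (∃ z : (L : Type), z ≠ 0 ∧
        (LiuIndex.line V (LiuIndex.repAt (aOneJ c)) (muLiu ι₁ LiuIndex.GramClass.rep) j).scalar = z * conjRingHomK L z * c.D.a 1) ∧
      ∀ (Γ : Level V) (hΓ : Γ.BelowConjThree),
        ∀ ω ∈ thetaOf _ (thetaClassInputOf _ (fun V c => thetaSpaceInputOf hHD hI h₁ h₃
            (SROGT'C @hGR @hGR₀ @hGR₁ @hGR₂ @hGR₃ @μ hΔ₁ hΔ₂ hΔ₃) V c)) V c 1 Γ,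
          ∃ cf : towerLevel hHD hI (ballQuotientUniformisedDatum_of h₁) h₃ hA Γ hΓ,
            TowerLevel.res hHD hI (ballQuotientUniformisedDatum_of h₁) h₃ hA cf = ω ∧
              (ofLevel hHD hI (ballQuotientUniformisedDatum_of h₁) h₃ hA Γ hΓ cf :
                  (liuDictionaryPin hHD hI h₁ h₃ hA V (LiuIndex.I V (LiuIndex.repAt (aOneJ c)) (muLiu ι₁ LiuIndex.GramClass.rep))
                    (LiuIndex.line V (LiuIndex.repAt (aOneJ c)) (muLiu ι₁ LiuIndex.GramClass.rep))).H) ∈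
                (liuDictionaryPin hHD hI h₁ h₃ hA V (LiuIndex.I V (LiuIndex.repAt (aOneJ c)) (muLiu ι₁ LiuIndex.GramClass.rep))
                  (LiuIndex.line V (LiuIndex.repAt (aOneJ c)) (muLiu ι₁ LiuIndex.GramClass.rep))).block j :=
  hJ_slot_one_block_of_lineRepOf hHD hI h₁ h₃ hA V c (SROGT'C @hGR @hGR₀ @hGR₁ @hGR₂ @hGR₃ @μ hΔ₁ hΔ₂ hΔ₃ V c)
    (hGR V c) (hGR₀ V c) (hGR₁ V c) (hGR₂ V c) (hGR₃ V c)
    (etaT₀ V c.D (EtaChi.η (@χVR @hGR @hGR₀ @hGR₁) (@χWR @hGR @hGR₀ @hGR₁ @μ) V c) (νR @hGR₁ V c))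
    (etaT₁ V c.D (EtaChi.η (@χVR @hGR @hGR₀ @hGR₁) (@χWR @hGR @hGR₀ @hGR₁ @μ) V c) (νR @hGR₁ V c))
    (etaT₂ V c.D (EtaChi.η (@χVR @hGR @hGR₀ @hGR₁) (@χWR @hGR @hGR₀ @hGR₁ @μ) V c) (ν'R @hGR₃ V c))
    (etaT₃ V c.D (EtaChi.η (@χVR @hGR @hGR₀ @hGR₁) (@χWR @hGR @hGR₀ @hGR₁ @μ) V c) (ν'R @hGR₃ V c))
    (SROGT'C_ιinf @hGR @hGR₀ @hGR₁ @hGR₂ @hGR₃ @μ hΔ₁ hΔ₂ hΔ₃ V c hc) (hG_GOG V c hc) hV hc.1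
    (muLiu ι₁ LiuIndex.GramClass.rep)
    (SROGT'C_P_ω_lineRepOf @hGR @hGR₀ @hGR₁ @hGR₂ @hGR₃ @μ hΔ₁ hΔ₂ hΔ₃ V c hc 1)
    (continuous_etaT₁ V c.D _ _ (EtaChi.hηc (@χVR @hGR @hGR₀ @hGR₁) (@χWR @hGR @hGR₀ @hGR₁ @μ) V c) (hνcR @hGR₁ V c))
    (posIdxEquivUnit (hpos_GOG V c hc).2.1) (negIdxEquivEmpty (hpos_GOG V c hc).2.1)
    (hχ_one_ROGTC @hGR @hGR₀ @hGR₁ @μ V c hc)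
    (defExponentOne V c (hGR₁ V c) (hpos_GOG V c hc).2.1) (defExponentOne_spec V c (hGR₁ V c) (hpos_GOG V c hc).2.1)
    (hdef_one_ROGTC @hGR @hGR₀ @hGR₁ @μ V c hc)
    (SROGT'C @hGR @hGR₀ @hGR₁ @hGR₂ @hGR₃ @μ hΔ₁ hΔ₂ hΔ₃) rfl
    (satG_le_SROGT'C_Gfin @hGR @hGR₀ @hGR₁ @hGR₂ @hGR₃ @μ hΔ₁ hΔ₂ hΔ₃ V c hc hV)
    (hLF_ROGT'C @hGR @hGR₀ @hGR₁ @hGR₂ @hGR₃ @μ hΔ₁ hΔ₂ hΔ₃ V c 1)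
    (etaT₁_V_rat V c _ (νR @hGR₁ V c) (hνR @hGR₁ V c))
    (etaT₁_W_rat V c _ (EtaChi.hη (@χVR @hGR @hGR₀ @hGR₁) (@χWR @hGR @hGR₀ @hGR₁ @μ) V c) (νR @hGR₁ V c) (hνR @hGR₁ V c))
    (continuous_adelicCharOne_val V c (hGR V c) (hGR₀ V c) (hGR₁ V c) _
      (continuous_etaT₁ V c.D _ _ (EtaChi.hηc (@χVR @hGR @hGR₀ @hGR₁) (@χWR @hGR @hGR₀ @hGR₁ @μ) V c) (hνcR @hGR₁ V c)) (hG_GOG V c hc))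
    (muLiu_mk_eq_add_ROGT'C_one @hGR @hGR₀ @hGR₁ @μ V c LiuIndex.GramClass.rep LiuIndex.GramClass.mk_rep hc
      (continuous_adelicCharOne_val V c (hGR V c) (hGR₀ V c) (hGR₁ V c) _
      (continuous_etaT₁ V c.D _ _ (EtaChi.hηc (@χVR @hGR @hGR₀ @hGR₁) (@χWR @hGR @hGR₀ @hGR₁ @μ) V c) (hνcR @hGR₁ V c)) (hG_GOG V c hc)))
    (fun t => w_ROGT'C_mul_lineCharV_one_eq_torusScalar @hGR @hGR₀ @hGR₁ @hGR₂ @hGR₃ @μ hΔ₁ hΔ₂ hΔ₃ V c hc t)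

/-- **slot 2 of the junction binder `hJ` AT THE PIN OF RECORD R2**, recipe of record `μ₀ := muLiu ι₁ rep`, EVERY hypothesis discharged
(binder-2 `hJ_slot_two_of_lineRepOf` ∘ binder-1 #R131 socket table ∘ sinst-1 #1272 ∘ carch #CA72∕73 `hw` ∘ this seat's #H2 `hμ`). [folklore] -/
theorem hJ_ROGT'C_block_two (hc : GOG V c) (hV : IsAnisotropic L V.Hm) :
    ∃ j : LiuIndex.I V (LiuIndex.repAt (aTwoJ c)) (muLiu ι₁ LiuIndex.GramClass.rep),
      (∃ z : (L : Type), z ≠ 0 ∧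
        (LiuIndex.line V (LiuIndex.repAt (aTwoJ c)) (muLiu ι₁ LiuIndex.GramClass.rep) j).scalar = z * conjRingHomK L z * c.D.a 2) ∧
      ∀ (Γ : Level V) (hΓ : Γ.BelowConjThree),
        ∀ ω ∈ thetaOf _ (thetaClassInputOf _ (fun V c => thetaSpaceInputOf hHD hI h₁ h₃
            (SROGT'C @hGR @hGR₀ @hGR₁ @hGR₂ @hGR₃ @μ hΔ₁ hΔ₂ hΔ₃) V c)) V c 2 Γ,
          ∃ cf : towerLevel hHD hI (ballQuotientUniformisedDatum_of h₁) h₃ hA Γ hΓ,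
            TowerLevel.res hHD hI (ballQuotientUniformisedDatum_of h₁) h₃ hA cf = ω ∧
              (ofLevel hHD hI (ballQuotientUniformisedDatum_of h₁) h₃ hA Γ hΓ cf :
                  (liuDictionaryPin hHD hI h₁ h₃ hA V (LiuIndex.I V (LiuIndex.repAt (aTwoJ c)) (muLiu ι₁ LiuIndex.GramClass.rep))
                    (LiuIndex.line V (LiuIndex.repAt (aTwoJ c)) (muLiu ι₁ LiuIndex.GramClass.rep))).H) ∈
                (liuDictionaryPin hHD hI h₁ h₃ hA V (LiuIndex.I V (LiuIndex.repAt (aTwoJ c)) (muLiu ι₁ LiuIndex.GramClass.rep))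
                  (LiuIndex.line V (LiuIndex.repAt (aTwoJ c)) (muLiu ι₁ LiuIndex.GramClass.rep))).block j :=
  hJ_slot_two_block_of_lineRepOf hHD hI h₁ h₃ hA V c (SROGT'C @hGR @hGR₀ @hGR₁ @hGR₂ @hGR₃ @μ hΔ₁ hΔ₂ hΔ₃ V c)
    (hGR V c) (hGR₀ V c) (hGR₁ V c) (hGR₂ V c) (hGR₃ V c)
    (etaT₀ V c.D (EtaChi.η (@χVR @hGR @hGR₀ @hGR₁) (@χWR @hGR @hGR₀ @hGR₁ @μ) V c) (νR @hGR₁ V c))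
    (etaT₁ V c.D (EtaChi.η (@χVR @hGR @hGR₀ @hGR₁) (@χWR @hGR @hGR₀ @hGR₁ @μ) V c) (νR @hGR₁ V c))
    (etaT₂ V c.D (EtaChi.η (@χVR @hGR @hGR₀ @hGR₁) (@χWR @hGR @hGR₀ @hGR₁ @μ) V c) (ν'R @hGR₃ V c))
    (etaT₃ V c.D (EtaChi.η (@χVR @hGR @hGR₀ @hGR₁) (@χWR @hGR @hGR₀ @hGR₁ @μ) V c) (ν'R @hGR₃ V c))
    (SROGT'C_ιinf @hGR @hGR₀ @hGR₁ @hGR₂ @hGR₃ @μ hΔ₁ hΔ₂ hΔ₃ V c hc) (hG_GOG V c hc) hV hc.1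
    (muLiu ι₁ LiuIndex.GramClass.rep)
    (SROGT'C_P_ω_lineRepOf @hGR @hGR₀ @hGR₁ @hGR₂ @hGR₃ @μ hΔ₁ hΔ₂ hΔ₃ V c hc 2)
    (continuous_etaT₂ V c.D _ _ (EtaChi.hηc (@χVR @hGR @hGR₀ @hGR₁) (@χWR @hGR @hGR₀ @hGR₁ @μ) V c) (hν'cR @hGR₃ V c))
    (posIdxEquivUnit (hpos_GOG V c hc).2.2.1) (negIdxEquivEmpty (hpos_GOG V c hc).2.2.1)
    (hχ_two_R2_of_GOG @hGR @hGR₀ @hGR₁ @hGR₂ @hGR₃ (@χWR @hGR @hGR₀ @hGR₁ @μ) V c hc)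
    (defExponentTwo V c (hGR₂ V c) (hpos_GOG V c hc).2.2.1) (defExponentTwo_spec V c (hGR₂ V c) (hpos_GOG V c hc).2.2.1)
    (hdef_two_R2_of_GOG @hGR @hGR₀ @hGR₁ @hGR₂ @hGR₃ (@χWR @hGR @hGR₀ @hGR₁ @μ) V c hc)
    (SROGT'C @hGR @hGR₀ @hGR₁ @hGR₂ @hGR₃ @μ hΔ₁ hΔ₂ hΔ₃) rfl
    (satG_le_SROGT'C_Gfin @hGR @hGR₀ @hGR₁ @hGR₂ @hGR₃ @μ hΔ₁ hΔ₂ hΔ₃ V c hc hV)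
    (hLF_ROGT'C @hGR @hGR₀ @hGR₁ @hGR₂ @hGR₃ @μ hΔ₁ hΔ₂ hΔ₃ V c 2)
    (etaT₂_V_rat V c _ (EtaChi.hη (@χVR @hGR @hGR₀ @hGR₁) (@χWR @hGR @hGR₀ @hGR₁ @μ) V c) (ν'R @hGR₃ V c) (hν'R @hGR₃ V c))
    (etaT₂_W_rat V c _ (EtaChi.hη (@χVR @hGR @hGR₀ @hGR₁) (@χWR @hGR @hGR₀ @hGR₁ @μ) V c) (ν'R @hGR₃ V c) (hν'R @hGR₃ V c))
    (continuous_adelicCharTwoG_val V c (hGR V c) (hGR₂ V c) (hGR₃ V c) _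
      (continuous_etaT₂ V c.D _ _ (EtaChi.hηc (@χVR @hGR @hGR₀ @hGR₁) (@χWR @hGR @hGR₀ @hGR₁ @μ) V c) (hν'cR @hGR₃ V c)) (hG_GOG V c hc))
    (muLiu_mk_eq_add_ROGT'C_two @hGR @hGR₀ @hGR₁ @hGR₂ @hGR₃ @μ V c LiuIndex.GramClass.rep LiuIndex.GramClass.mk_rep hc
      (continuous_adelicCharTwoG_val V c (hGR V c) (hGR₂ V c) (hGR₃ V c) _
      (continuous_etaT₂ V c.D _ _ (EtaChi.hηc (@χVR @hGR @hGR₀ @hGR₁) (@χWR @hGR @hGR₀ @hGR₁ @μ) V c) (hν'cR @hGR₃ V c)) (hG_GOG V c hc)))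
    (fun t => w_ROGT'C_mul_lineCharV_two_eq_torusScalar @hGR @hGR₀ @hGR₁ @hGR₂ @hGR₃ @μ hΔ₁ hΔ₂ hΔ₃ V c hc t)

/-- **slot 3 of the junction binder `hJ` AT THE PIN OF RECORD R2**, recipe of record `μ₀ := muLiu ι₁ rep`, EVERY hypothesis discharged
(binder-2 `hJ_slot_three_of_lineRepOf` ∘ binder-1 #R131 socket table ∘ sinst-1 #1272 ∘ carch #CA72∕73 `hw` ∘ this seat's #H2 `hμ`). [folklore] -/
theorem hJ_ROGT'C_block_three (hc : GOG V c) (hV : IsAnisotropic L V.Hm) :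
    ∃ j : LiuIndex.I V (LiuIndex.repAt (aThreeJ c)) (muLiu ι₁ LiuIndex.GramClass.rep),
      (∃ z : (L : Type), z ≠ 0 ∧
        (LiuIndex.line V (LiuIndex.repAt (aThreeJ c)) (muLiu ι₁ LiuIndex.GramClass.rep) j).scalar = z * conjRingHomK L z * c.D.a 3) ∧
      ∀ (Γ : Level V) (hΓ : Γ.BelowConjThree),
        ∀ ω ∈ thetaOf _ (thetaClassInputOf _ (fun V c => thetaSpaceInputOf hHD hI h₁ h₃
            (SROGT'C @hGR @hGR₀ @hGR₁ @hGR₂ @hGR₃ @μ hΔ₁ hΔ₂ hΔ₃) V c)) V c 3 Γ,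
          ∃ cf : towerLevel hHD hI (ballQuotientUniformisedDatum_of h₁) h₃ hA Γ hΓ,
            TowerLevel.res hHD hI (ballQuotientUniformisedDatum_of h₁) h₃ hA cf = ω ∧
              (ofLevel hHD hI (ballQuotientUniformisedDatum_of h₁) h₃ hA Γ hΓ cf :
                  (liuDictionaryPin hHD hI h₁ h₃ hA V (LiuIndex.I V (LiuIndex.repAt (aThreeJ c)) (muLiu ι₁ LiuIndex.GramClass.rep))
                    (LiuIndex.line V (LiuIndex.repAt (aThreeJ c)) (muLiu ι₁ LiuIndex.GramClass.rep))).H) ∈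
                (liuDictionaryPin hHD hI h₁ h₃ hA V (LiuIndex.I V (LiuIndex.repAt (aThreeJ c)) (muLiu ι₁ LiuIndex.GramClass.rep))
                  (LiuIndex.line V (LiuIndex.repAt (aThreeJ c)) (muLiu ι₁ LiuIndex.GramClass.rep))).block j :=
  hJ_slot_three_block_of_lineRepOf hHD hI h₁ h₃ hA V c (SROGT'C @hGR @hGR₀ @hGR₁ @hGR₂ @hGR₃ @μ hΔ₁ hΔ₂ hΔ₃ V c)
    (hGR V c) (hGR₀ V c) (hGR₁ V c) (hGR₂ V c) (hGR₃ V c)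
    (etaT₀ V c.D (EtaChi.η (@χVR @hGR @hGR₀ @hGR₁) (@χWR @hGR @hGR₀ @hGR₁ @μ) V c) (νR @hGR₁ V c))
    (etaT₁ V c.D (EtaChi.η (@χVR @hGR @hGR₀ @hGR₁) (@χWR @hGR @hGR₀ @hGR₁ @μ) V c) (νR @hGR₁ V c))
    (etaT₂ V c.D (EtaChi.η (@χVR @hGR @hGR₀ @hGR₁) (@χWR @hGR @hGR₀ @hGR₁ @μ) V c) (ν'R @hGR₃ V c))
    (etaT₃ V c.D (EtaChi.η (@χVR @hGR @hGR₀ @hGR₁) (@χWR @hGR @hGR₀ @hGR₁ @μ) V c) (ν'R @hGR₃ V c))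
    (SROGT'C_ιinf @hGR @hGR₀ @hGR₁ @hGR₂ @hGR₃ @μ hΔ₁ hΔ₂ hΔ₃ V c hc) (hG_GOG V c hc) hV hc.1
    (muLiu ι₁ LiuIndex.GramClass.rep)
    (SROGT'C_P_ω_lineRepOf @hGR @hGR₀ @hGR₁ @hGR₂ @hGR₃ @μ hΔ₁ hΔ₂ hΔ₃ V c hc 3)
    (continuous_etaT₃ V c.D _ _ (EtaChi.hηc (@χVR @hGR @hGR₀ @hGR₁) (@χWR @hGR @hGR₀ @hGR₁ @μ) V c) (hν'cR @hGR₃ V c))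
    (posIdxEquivUnit (hpos_GOG V c hc).2.2.2) (negIdxEquivEmpty (hpos_GOG V c hc).2.2.2)
    (hχ_three_R2_of_GOG @hGR @hGR₀ @hGR₁ @hGR₂ @hGR₃ (@χWR @hGR @hGR₀ @hGR₁ @μ) V c hc)
    (defExponentThree V c (hGR₃ V c) (hpos_GOG V c hc).2.2.2) (defExponentThree_spec V c (hGR₃ V c) (hpos_GOG V c hc).2.2.2)
    (hdef_three_R2_of_GOG @hGR @hGR₀ @hGR₁ @hGR₂ @hGR₃ (@χWR @hGR @hGR₀ @hGR₁ @μ) V c hc)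
    (SROGT'C @hGR @hGR₀ @hGR₁ @hGR₂ @hGR₃ @μ hΔ₁ hΔ₂ hΔ₃) rfl
    (satG_le_SROGT'C_Gfin @hGR @hGR₀ @hGR₁ @hGR₂ @hGR₃ @μ hΔ₁ hΔ₂ hΔ₃ V c hc hV)
    (hLF_ROGT'C @hGR @hGR₀ @hGR₁ @hGR₂ @hGR₃ @μ hΔ₁ hΔ₂ hΔ₃ V c 3)
    (etaT₃_V_rat V c _ (ν'R @hGR₃ V c) (hν'R @hGR₃ V c))
    (etaT₃_W_rat V c _ (EtaChi.hη (@χVR @hGR @hGR₀ @hGR₁) (@χWR @hGR @hGR₀ @hGR₁ @μ) V c) (ν'R @hGR₃ V c) (hν'R @hGR₃ V c))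
    (continuous_adelicCharThree_val V c (hGR V c) (hGR₂ V c) (hGR₃ V c) _
      (continuous_etaT₃ V c.D _ _ (EtaChi.hηc (@χVR @hGR @hGR₀ @hGR₁) (@χWR @hGR @hGR₀ @hGR₁ @μ) V c) (hν'cR @hGR₃ V c)) (hG_GOG V c hc))
    (muLiu_mk_eq_add_ROGT'C_three @hGR @hGR₀ @hGR₁ @hGR₂ @hGR₃ @μ V c LiuIndex.GramClass.rep LiuIndex.GramClass.mk_rep hc
      (continuous_adelicCharThree_val V c (hGR V c) (hGR₂ V c) (hGR₃ V c) _
      (continuous_etaT₃ V c.D _ _ (EtaChi.hηc (@χVR @hGR @hGR₀ @hGR₁) (@χWR @hGR @hGR₀ @hGR₁ @μ) V c) (hν'cR @hGR₃ V c)) (hG_GOG V c hc)))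
    (fun t => w_ROGT'C_mul_lineCharV_three_eq_torusScalar @hGR @hGR₀ @hGR₁ @hGR₂ @hGR₃ @μ hΔ₁ hΔ₂ hΔ₃ V c hc t)

/-! ## § 2  The junction binder `hJ` of «ATqI» AT THE PIN OF RECORD, all four slots (`∀ i : Fin 4`) -/

/-- **«ATqI»'s `hJ` AT THE PIN OF RECORD R2, recipe of record, NO residual hypothesis**: for every slot `i : Fin 4` (index section pointed at
`a_i := ⟨c.D.a i, …⟩`, binder-2 #103 `repAt`), ONE index `j` isometric to the slot line and, for every theta class of the pin's
theta model at every tower level, a tower vector restricting to it inside the ONE block `block j` of the pinned dictionary. [folklore] -/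
theorem hJ_ROGT'C_block (hc : GOG V c) (hV : IsAnisotropic L V.Hm) (i : Fin 4) :
    ∃ j : LiuIndex.I V (LiuIndex.repAt (⟨c.D.a i, c.D.a_real i, c.D.a_ne i⟩ : LiuIndex.RealScalar L))
        (muLiu ι₁ LiuIndex.GramClass.rep),
      (∃ z : (L : Type), z ≠ 0 ∧
        (LiuIndex.line V (LiuIndex.repAt (⟨c.D.a i, c.D.a_real i, c.D.a_ne i⟩ : LiuIndex.RealScalar L))
          (muLiu ι₁ LiuIndex.GramClass.rep) j).scalar = z * conjRingHomK L z * c.D.a i) ∧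
      ∀ (Γ : Level V) (hΓ : Γ.BelowConjThree),
        ∀ ω ∈ thetaOf _ (thetaClassInputOf _ (fun V c => thetaSpaceInputOf hHD hI h₁ h₃
            (SROGT'C @hGR @hGR₀ @hGR₁ @hGR₂ @hGR₃ @μ hΔ₁ hΔ₂ hΔ₃) V c)) V c i Γ,
          ∃ cf : towerLevel hHD hI (ballQuotientUniformisedDatum_of h₁) h₃ hA Γ hΓ,
            TowerLevel.res hHD hI (ballQuotientUniformisedDatum_of h₁) h₃ hA cf = ω ∧
              (ofLevel hHD hI (ballQuotientUniformisedDatum_of h₁) h₃ hA Γ hΓ cf :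
                  (liuDictionaryPin hHD hI h₁ h₃ hA V
                    (LiuIndex.I V (LiuIndex.repAt (⟨c.D.a i, c.D.a_real i, c.D.a_ne i⟩ : LiuIndex.RealScalar L))
                      (muLiu ι₁ LiuIndex.GramClass.rep))
                    (LiuIndex.line V (LiuIndex.repAt (⟨c.D.a i, c.D.a_real i, c.D.a_ne i⟩ : LiuIndex.RealScalar L))
                      (muLiu ι₁ LiuIndex.GramClass.rep))).H) ∈
                (liuDictionaryPin hHD hI h₁ h₃ hA V
                    (LiuIndex.I V (LiuIndex.repAt (⟨c.D.a i, c.D.a_real i, c.D.a_ne i⟩ : LiuIndex.RealScalar L))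
                      (muLiu ι₁ LiuIndex.GramClass.rep))
                    (LiuIndex.line V (LiuIndex.repAt (⟨c.D.a i, c.D.a_real i, c.D.a_ne i⟩ : LiuIndex.RealScalar L))
                      (muLiu ι₁ LiuIndex.GramClass.rep))).block j := by
  fin_cases i
  · exact hJ_ROGT'C_block_zero hHD hI h₁ h₃ hA @hGR @hGR₀ @hGR₁ @hGR₂ @hGR₃ @μ hΔ₁ hΔ₂ hΔ₃ V c hc hV
  · exact hJ_ROGT'C_block_one hHD hI h₁ h₃ hA @hGR @hGR₀ @hGR₁ @hGR₂ @hGR₃ @μ hΔ₁ hΔ₂ hΔ₃ V c hc hV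
  · exact hJ_ROGT'C_block_two hHD hI h₁ h₃ hA @hGR @hGR₀ @hGR₁ @hGR₂ @hGR₃ @μ hΔ₁ hΔ₂ hΔ₃ V c hc hV
  · exact hJ_ROGT'C_block_three hHD hI h₁ h₃ hA @hGR @hGR₀ @hGR₁ @hGR₂ @hGR₃ @μ hΔ₁ hΔ₂ hΔ₃ V c hc hV

/-! ## § 3  E's `hsmall` AT THE PIN OF RECORD from `Thm418C` alone — the (J-Liu-Θ) JUNCTION THEOREM, single-block form -/

/-- **THE (J-Liu-Θ) JUNCTION THEOREM AT THE PIN OF RECORD R2, FROM `Thm418C` ALONE.**  For any theta model `R` on the model universe whose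
theta sets lie in the theta classes of the pin `SROGT'C` (E's `thetaModelOf …` over the pin: `hRΘ := fun _ _ => subset_rfl`), the combined
reading `Thm418C` (r8) of [Liu21, Thm. 4.18 + (4.3) + (1) + Rem. 4.17 + Prop. 4.13 + Lem. 2.4 (1)] over the pinned dictionary at the recipe of
record `μ₀ := LiuIndex.muLiu ι₁ rep` (`h418`, read at the slot's pointing scalar) and Riemann's theorem `hR` give E's binder `hsmall` at
`(V, c, i)` (witnesses `M := c.K`, `k := id`, `σ' := c.σ`; this seat's `hsmall_of_weilFamilyAut_at_block_of_isometric` ∘ § 2).  BINDERS LEFT: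
the pin's own inputs `hGR hGR₀ hGR₁ hGR₂ hGR₃` ([GR91, Prop. 3.1.1]), `μ` (DATA), `hΔ₁ hΔ₂ hΔ₃` ((J-μ)), `hR` (vendored theorem), and `h418` —
ONE sentence-reading; `Irreducible ∕ Prop413 ∕ Thm418_2 ∕ MuSeparated` do not occur. [folklore] -/
theorem hsmall_ROGT'C_of_thm418C (hR : DeligneMilne1982_Thm_6_20_full)
    (R : (picardCMUniverse hHD hI h₁ h₃).ThetaModel)
    (hRΘ : ∀ (i : Fin 4) (Γ : Level V), R.Theta V c i Γ ⊆
      thetaOf _ (thetaClassInputOf _ (fun V c => thetaSpaceInputOf hHD hI h₁ h₃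
        (SROGT'C @hGR @hGR₀ @hGR₁ @hGR₂ @hGR₃ @μ hΔ₁ hΔ₂ hΔ₃) V c)) V c i Γ)
    (h418 : ∀ a₀ : LiuIndex.RealScalar L,
      (liuDictionaryPin hHD hI h₁ h₃ hA V (LiuIndex.I V (LiuIndex.repAt a₀) (muLiu ι₁ LiuIndex.GramClass.rep))
          (LiuIndex.line V (LiuIndex.repAt a₀) (muLiu ι₁ LiuIndex.GramClass.rep))).Thm418C)
    (hgood : R.GoodCtx ι₁ c) (hc : GOG V c)
    (h6 : Module.finrank ℚ c.K = 6 ∧ IsNormalClosure ℚ c.K L ∧ (Module.finrank ℚ L = 24 ∨ Module.finrank ℚ L = 48))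
    (i : Fin 4) :
    ∃ Γ₀ : Level V, ∀ Γ ≤ Γ₀,
      ∃ (M : CMField) (k : c.K →+* M) (σ' : M →+* ℂ), σ'.comp k = c.σ ∧
        R.Theta V c i Γ ⊆ (picardCMUniverse hHD hI h₁ h₃).Uiso Γ M (CMTypeOps.inflate k (c.Ψ i)) σ' := by
  have hV : IsAnisotropic L V.Hm := HermSpace3.isAnisotropic V (by rcases h6.2.2 with h | h <;> omega)
  obtain ⟨j, hj, hfam⟩ := hJ_ROGT'C_block hHD hI h₁ h₃ hA @hGR @hGR₀ @hGR₁ @hGR₂ @hGR₃ @μ hΔ₁ hΔ₂ hΔ₃ V c hc hV i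
  exact hsmall_of_weilFamilyAut_at_block_of_isometric hHD hI h₁ h₃ hA V (ιVE V) _ _ hR R c
    (h418 ⟨c.D.a i, c.D.a_real i, c.D.a_ne i⟩) hgood hc.2 h6 i ⟨j, hj, fun Γ hΓ ω hω => hfam Γ hΓ ω (hRΘ i Γ hω)⟩

end HodgeCM.Model.SInstance

end
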